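import Summits.ABC.IUTFork.Joshi.ATS4LogDiffConductorIdentity
import Summits.ABC.IUTFork.Joshi.ATS4LogDiffConductorTame
import Summits.ABC.IUTFork.Joshi.ATS4LogDiffConductorTauGalois
import HarnessLib

/-!
# Joshi, *Arithmetic Teichmüller Spaces IV* (arXiv:2403.10430v2) Thm. 4.6.1 (1), (3), (4) AS PRINTED — DECIDED in kernel over
# Mathlib number fields: each holds iff `M/L` is unramified outside `V^{odd,ss}_M`

Proof-only companion of `Joshi/ATS4LogDiffConductor.lean` (abc-iut cell, branch E, rung LADDER-ABC:A2.E; seat abc-iut-E-t27,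
slot T-27). **No side is taken** on [IUTchIII] Cor. 3.12, on Joshi's claims, or on Mochizuki's reports on them; the source is an
unrefereed arXiv preprint. Locators «p.N l.M» refer to the render `HOME/lit/renders/Joshi-arxiv-2403.10430/` (v2).

The typed file records Thm. 4.6.1 (1) (in the proof's form (4.6.8)), (3) and (4) (p.46 l.25–41) as the claims `Formula461 L M S`,
`DependsOnlyOnWild L M S`, `EqIffTame L M S` (`S = V^{odd,ss}_L`, `ssAbove L M S = V^{odd,ss}_M`), with flag F-b: the printed
derivation computes the conductor on all places ((4.6.6)) although §4.4 supports it on `V^{odd,ss}` only. With the exact identity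
(`ATS4LogDiffConductorIdentity`: `[M:ℚ]·Δ = Σ τ_w·log N(w) + Σ_{w ∉ V^{odd,ss}_M} (e_w − 1)·log N(w)`) and Serre III §6 Prop. 13
(`ATS4LogDiffConductorTame`: `τ_w = 0 ↔ tame`), the three claims are DECIDED here, for EVERY extension of number fields `M/L`
and every finite `S`, relative to one elementary ramification condition:

* `formula461_iff` — **(1) as printed ⟺ `M/L` is unramified at every prime outside `V^{odd,ss}_M`**;
* `dependsOnlyOnWild_iff` — **(3) ⟺ the same condition** (the wild-restricted sum always equals the full `τ`-sum);
* `eqIffTame_iff` — **(4) ⟺ (`M/L` tamely ramified ⇒ `M/L` unramified outside `V^{odd,ss}_M`)**; in particular (4) FAILS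
  exactly for the extensions that are tamely ramified everywhere but ramified somewhere outside `V^{odd,ss}_M`
  (`not_eqIffTame`), and HOLDS whenever `M/L` is unramified outside `V^{odd,ss}_M` (`eqIffTame_of_unramified_outside`).

Also: `tauBounds_of_isGalois` — the typed `TauBounds L M` ((4.6.4) in full) PROVED for Galois `M/L` (assembling
`ATS4LogDiffConductorTame` and `ATS4LogDiffConductorTauGalois`).

So the printed items are correct precisely under the hypothesis «M/L unramified outside V^{odd,ss}_L» that the printed proof
silently uses — LOCATED and kernel-decided; the ref-x / E-cx lanes double-read; nothing here adjudicates any other text or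
author. Theorems only; standard axioms; no `sorry`, instance, notation or new `Prop` fact.
[claim: Joshi2024ATS4, status: disputed] (provenance of the typed items; nothing endorsed).
-/

noncomputable section

namespace Summit.ABC.IUTFork.Joshi.ATS4

namespace LogDiffCond

open NumberField IsDedekindDomain Ideal Module Literature.IUT.LogVolume
open scoped Classical

variable (L M : Type*) [Field L] [NumberField L] [Field M] [NumberField M] [Algebra L M]

/-! ### The `τ`-sum as a finite sum -/

omit [NumberField L] in
/-- `τ_w ≠ 0 ⇒ d_w ≠ 0` (`τ ≤ d`). [folklore] -/
theorem relDiffExp_ne_zero_of_tau_ne_zero (w : HeightOneSpectrum (𝓞 M)) (h : tau L M w ≠ 0) : relDiffExp L M w ≠ 0 := by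
  unfold tau at h; omega

omit [NumberField L] in
/-- The `finsum` of (4.6.8) is a finite sum over any `D` carrying the relative different. [folklore] -/
theorem finsum_tau_eq_sum (D : Finset (HeightOneSpectrum (𝓞 M))) (hD : ∀ w, relDiffExp L M w ≠ 0 → w ∈ D) :
    ∑ᶠ w : HeightOneSpectrum (𝓞 M), (tau L M w : ℝ) * Real.log (absNorm w.asIdeal : ℝ) =
      ∑ w ∈ D, (tau L M w : ℝ) * logNorm M w := by
  rw [finsum_eq_sum_of_support_subset _ (s := D) ?_]
  · rfl
  · intro w hw
    rw [Function.mem_support] at hw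
    have hτ : (tau L M w : ℝ) ≠ 0 := fun h0 => hw (by rw [h0, zero_mul])
    exact Finset.mem_coe.mpr (hD w (relDiffExp_ne_zero_of_tau_ne_zero L M w (by exact_mod_cast hτ)))

/-- At a tamely ramified prime the wild-restricted summand and the full summand agree (both are `τ_w·log N(w)`, `= 0` when tame).
[folklore] -/
theorem wildSummand_eq (w : HeightOneSpectrum (𝓞 M)) :
    (if IsTameAt L M w then (0 : ℝ) else (tau L M w : ℝ) * Real.log (absNorm w.asIdeal : ℝ)) =
      (tau L M w : ℝ) * Real.log (absNorm w.asIdeal : ℝ) := by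
  split_ifs with h
  · rw [(tau_eq_zero_iff_isTameAt L M w).mpr h, Nat.cast_zero, zero_mul]
  · rfl

/-! ### The dropped term vanishes iff `M/L` is unramified outside `V^{odd,ss}_M` -/

/-- If `Δ·[M:ℚ]` equals the `τ`-sum alone, then every prime outside `V^{odd,ss}_M` is unramified (the dropped nonnegative term must
vanish termwise; `log N(w) > 0`). [cite: MochizukiGenEll2010, Prop 1.7 (i) p.9] -/
theorem unramified_outside_of_delta_eq_tau_sum (S : Finset (HeightOneSpectrum (𝓞 L)))
    (h : ∀ (D : Finset (HeightOneSpectrum (𝓞 M))), ssAbove L M S ⊆ D → (∀ w, relDiffExp L M w ≠ 0 → w ∈ D) →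
      (finrank ℚ M : ℝ) * (logDiffCond M (ssAbove L M S) - logDiffCond L S) = ∑ w ∈ D, (tau L M w : ℝ) * logNorm M w)
    (w₀ : HeightOneSpectrum (𝓞 M)) (hw₀ : w₀ ∉ ssAbove L M S) : relRamIdx L M w₀ = 1 := by
  obtain ⟨D₀, hTD₀, hD₀⟩ := exists_support L M S
  set D := insert w₀ D₀
  have hTD : ssAbove L M S ⊆ D := hTD₀.trans (Finset.subset_insert _ _)
  have hD : ∀ w, relDiffExp L M w ≠ 0 → w ∈ D := fun w hw => Finset.mem_insert_of_mem (hD₀ w hw)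
  have key := finrank_mul_delta_eq_tau_add L M S D hTD hD
  rw [h D hTD hD] at key
  have hzero : ∑ w ∈ D with w ∉ ssAbove L M S, ((relRamIdx L M w : ℝ) - 1) * logNorm M w = 0 := by linarith
  have hterm : ∀ w ∈ D.filter (fun w => w ∉ ssAbove L M S), 0 ≤ ((relRamIdx L M w : ℝ) - 1) * logNorm M w :=
    fun w _ => mul_nonneg (by
      have h1 : (1 : ℝ) ≤ relRamIdx L M w := by exact_mod_cast one_le_relRamIdx L M w
      linarith) (logNorm_pos M w).le
  have hmem : w₀ ∈ D.filter (fun w => w ∉ ssAbove L M S) := by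
    rw [Finset.mem_filter]; exact ⟨Finset.mem_insert_self _ _, hw₀⟩
  have h0 := (Finset.sum_eq_zero_iff_of_nonneg hterm).mp hzero w₀ hmem
  rcases mul_eq_zero.mp h0 with h1 | h2
  · have := one_le_relRamIdx L M w₀
    exact_mod_cast (by linarith : (relRamIdx L M w₀ : ℝ) = 1)
  · exact absurd h2 (logNorm_pos M w₀).ne'

/-! ### (1) decided -/

/-- **[J-IV] Thm. 4.6.1 (1) in the form (4.6.8), DECIDED**: `Formula461 L M S` holds **iff** `M/L` is unramified at every prime
of `M` outside `V^{odd,ss}_M` (p.46 l.25–35 / p.48 l.14–24; flag F-b). [cite: MochizukiGenEll2010, Prop 1.7 (i) p.9] -/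
theorem formula461_iff (S : Finset (HeightOneSpectrum (𝓞 L))) :
    Formula461 L M S ↔ ∀ w : HeightOneSpectrum (𝓞 M), w ∉ ssAbove L M S → relRamIdx L M w = 1 := by
  have hM : (0 : ℝ) < finrank ℚ M := by exact_mod_cast finrank_pos
  constructor
  · intro hF
    refine unramified_outside_of_delta_eq_tau_sum L M S fun D _ hD => ?_
    have h := hF
    unfold Formula461 at h
    rw [h, finsum_tau_eq_sum L M D hD, ← mul_assoc, mul_inv_cancel₀ hM.ne', one_mul]
  · intro hunr
    obtain ⟨D, hTD, hD⟩ := exists_support L M S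
    have key := finrank_mul_delta_eq_tau_of_unramified_outside L M S D hTD hD hunr
    unfold Formula461
    rw [finsum_tau_eq_sum L M D hD, ← key, ← mul_assoc, inv_mul_cancel₀ hM.ne', one_mul]

/-! ### (3) decided -/

/-- (3) and (1) have the same right-hand side: the wild-restricted sum IS the `τ`-sum (`τ_w = 0` at tame `w`). [folklore] -/
theorem dependsOnlyOnWild_iff_formula461 (S : Finset (HeightOneSpectrum (𝓞 L))) :
    DependsOnlyOnWild L M S ↔ Formula461 L M S := by
  unfold DependsOnlyOnWild Formula461
  rw [finsum_congr (wildSummand_eq L M)]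

/-- **[J-IV] Thm. 4.6.1 (3), DECIDED**: «depends only on wildly ramified primes» (p.46 l.38–40) holds **iff** `M/L` is unramified
outside `V^{odd,ss}_M`. [cite: MochizukiGenEll2010, Prop 1.7 (i) p.9] -/
theorem dependsOnlyOnWild_iff (S : Finset (HeightOneSpectrum (𝓞 L))) :
    DependsOnlyOnWild L M S ↔ ∀ w : HeightOneSpectrum (𝓞 M), w ∉ ssAbove L M S → relRamIdx L M w = 1 := by
  rw [dependsOnlyOnWild_iff_formula461, formula461_iff]

/-! ### (4) decided -/

/-- `Δ = 0` **iff** `M/L` is tamely ramified everywhere AND unramified outside `V^{odd,ss}_M` (all terms of the identity are `≥ 0`;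
`τ_w = 0 ↔ tame`). [cite: MochizukiGenEll2010, Prop 1.7 (i) p.9] -/
theorem delta_eq_zero_iff (S : Finset (HeightOneSpectrum (𝓞 L))) :
    logDiffCond M (ssAbove L M S) = logDiffCond L S ↔
      IsTame L M ∧ ∀ w : HeightOneSpectrum (𝓞 M), w ∉ ssAbove L M S → relRamIdx L M w = 1 := by
  constructor
  · intro h0
    obtain ⟨D, hTD, hD⟩ := exists_support L M S
    have key := finrank_mul_delta_eq_tau_add L M S D hTD hD
    rw [h0, sub_self, mul_zero] at key
    have hnn1 : ∀ w ∈ D, 0 ≤ (tau L M w : ℝ) * logNorm M w :=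
      fun w _ => mul_nonneg (Nat.cast_nonneg _) (logNorm_pos M w).le
    have hnn2 : ∀ w ∈ D.filter (fun w => w ∉ ssAbove L M S), 0 ≤ ((relRamIdx L M w : ℝ) - 1) * logNorm M w :=
      fun w _ => mul_nonneg (by
        have h1 : (1 : ℝ) ≤ relRamIdx L M w := by exact_mod_cast one_le_relRamIdx L M w
        linarith) (logNorm_pos M w).le
    have hs1 : ∑ w ∈ D, (tau L M w : ℝ) * logNorm M w = 0 := by
      have := Finset.sum_nonneg hnn1; have := Finset.sum_nonneg hnn2; linarith
    have hs2 : ∑ w ∈ D with w ∉ ssAbove L M S, ((relRamIdx L M w : ℝ) - 1) * logNorm M w = 0 := by linarith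
    refine ⟨fun w => ?_, fun w hw => ?_⟩
    · -- every τ_w = 0: on `D` from `hs1`, off `D` because `d_w = 0`
      rw [← tau_eq_zero_iff_isTameAt]
      by_cases hwD : w ∈ D
      · have h := (Finset.sum_eq_zero_iff_of_nonneg hnn1).mp hs1 w hwD
        rcases mul_eq_zero.mp h with h1 | h2
        · exact_mod_cast h1
        · exact absurd h2 (logNorm_pos M w).ne'
      · have hd : relDiffExp L M w = 0 := by by_contra hne; exact hwD (hD w hne)
        unfold tau; omega
    · by_cases hwD : w ∈ D
      · have hmem : w ∈ D.filter (fun w => w ∉ ssAbove L M S) := Finset.mem_filter.mpr ⟨hwD, hw⟩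
        have h := (Finset.sum_eq_zero_iff_of_nonneg hnn2).mp hs2 w hmem
        rcases mul_eq_zero.mp h with h1 | h2
        · have := one_le_relRamIdx L M w
          exact_mod_cast (by linarith : (relRamIdx L M w : ℝ) = 1)
        · exact absurd h2 (logNorm_pos M w).ne'
      · have hd : relDiffExp L M w = 0 := by by_contra hne; exact hwD (hD w hne)
        have h := relDiffExp_eq_tau_add L M w
        have := one_le_relRamIdx L M w
        omega
  · rintro ⟨htame, hunr⟩
    exact delta_eq_zero_of_isTame_of_unramified_outside L M S htame hunr

/-- **[J-IV] Thm. 4.6.1 (4), DECIDED**: «(log d_M + log f_M) = (log d_L + log f_L) iff M/L is tamely ramified» (p.46 l.41) holds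
**iff** (`M/L` tamely ramified ⇒ `M/L` unramified outside `V^{odd,ss}_M`). [cite: MochizukiGenEll2010, Prop 1.7 (i) p.9] -/
theorem eqIffTame_iff (S : Finset (HeightOneSpectrum (𝓞 L))) :
    EqIffTame L M S ↔ (IsTame L M → ∀ w : HeightOneSpectrum (𝓞 M), w ∉ ssAbove L M S → relRamIdx L M w = 1) := by
  unfold EqIffTame
  rw [delta_eq_zero_iff]
  tauto

/-- (4) HOLDS for every `M/L` unramified outside `V^{odd,ss}_M` (the hypothesis flag F-b names).
[cite: MochizukiGenEll2010, Prop 1.7 (i) p.9] -/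
theorem eqIffTame_of_unramified_outside (S : Finset (HeightOneSpectrum (𝓞 L)))
    (hunr : ∀ w : HeightOneSpectrum (𝓞 M), w ∉ ssAbove L M S → relRamIdx L M w = 1) : EqIffTame L M S :=
  (eqIffTame_iff L M S).mpr fun _ => hunr

/-- (4) FAILS for every `M/L` that is tamely ramified everywhere but ramified at some prime outside `V^{odd,ss}_M` (such `M` exist
over every number field `L`; e.g. `L = ℚ`, `M = ℚ(ζ_p)`, `S = ∅`). Located, not adjudicated. [cite: MochizukiGenEll2010, Prop 1.7 (i) p.9] -/
theorem not_eqIffTame (S : Finset (HeightOneSpectrum (𝓞 L))) (htame : IsTame L M) (w₀ : HeightOneSpectrum (𝓞 M))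
    (hw₀ : w₀ ∉ ssAbove L M S) (hram : relRamIdx L M w₀ ≠ 1) : ¬ EqIffTame L M S := fun h =>
  hram ((eqIffTame_iff L M S).mp h htame w₀ hw₀)

/-! ### (4.6.4) in full for Galois extensions -/

/-- **The typed `TauBounds` ((4.6.4): «τ = 0 iff tame; 1 ≤ τ ≤ e·ord_v(e) if wild») PROVED for `M/L` Galois**, assembling
`tau_eq_zero_iff_isTameAt`, `one_le_tau_of_not_isTameAt` (Serre III §6 Prop. 13) and `tau_le_of_isGalois` (Bombieri–Gubler
B.2.11 + the extension law). The non-Galois upper bound (B.2.12) remains the hypothesis. [cite: BombieriGubler2006, Thm B.2.11] -/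
theorem tauBounds_of_isGalois [IsGalois L M] : TauBounds L M := fun w =>
  ⟨tau_eq_zero_iff_isTameAt L M w, fun hw => ⟨one_le_tau_of_not_isTameAt L M w hw, tau_le_of_isGalois L M w⟩⟩

end LogDiffCond

end Summit.ABC.IUTFork.Joshi.ATS4

end
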